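import Summits.ResolutionOfSingularities.ResolutionOfSingularities.Theorems.SplitCutCells
import Summits.ResolutionOfSingularities.ResolutionOfSingularities.Theorems.MaxOrderAtomClasses
import Literature.AlgebraicGeometry.Resolution.HironakaTauScheme
import Literature.AlgebraicGeometry.Resolution.BlowupSequences
import Literature.AlgebraicGeometry.Resolution.MarkedIdeals
import Literature.AlgebraicGeometry.Resolution.StalkSpecializesLocalization
import Mathlib.Algebra.CharP.Defs
import Mathlib.Algebra.CharP.Lemmas
import Mathlib.Data.Nat.Multiplicity
import Mathlib.AlgebraicGeometry.Morphisms.Smooth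
import HarnessLib

/-!
# CylinderCutClasses — decomp-res node «CylinderCut» (lens-2 g18), file 1/2 of `CylinderCutClasses`

[WRITER NOTE (decomp-res writer g10).  Content VERBATIM from the decomp-res lens-2 g18 node
`HOME/decomp-res-lens-2/g18/CylinderCut.lean` (pin d60dded1, 2 862 l; HOME = run/shared/lean/pub/decomp-res);
CRITIC-LEDGER row 150 (+1); landing orders INBOX :446: land the NEW PART ONLY (§C l. 2356–2619 + §U l. 2621–2859) —
the SplitCut restatement §R17 (l. 124–2354, itself
carrying g14–g17 verbatim) is DELETED and the landed modules imported instead (namespaces `…Theorems.PinchCut`,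
`…Theorems.JetCut`, `…Theorems.PurityCut`, `…Theorems.SplitCut`
opened; same short names, byte-identical bodies — never two copies).  Namespace `…Theorems.CylinderCut` (the lens's
`Theses.CylinderCut` is gate-reserved), sub-namespace `Cyl`
as in the lens; file split only (tree files ≤ 400 lines): sections, variables, the mid-file `open MvPolynomial` and
every declaration exactly as in the lens; the node's
global dupNamespace-linter line dropped.  Node files, in import order: `CylinderCutClasses` (§C + the cone-free head
of §U; continued `…2` where the cap cuts) ·
`CylinderCutCells` (§U2–§U4 cone-free: the aside home) · the wiring `MaxContactCutCylinderCut` (§C bridge kernel +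
§U BY NAME on the host route, in the Theses cone; imports
`MaxContactCutSplitCut` and the tree's `MaxContactCutTauLadder` ⊃ `MaxContactCutExhaustion`).  All `--supports
stmt-ResolutionOfSingularities-29273` (`MaxContactCut.RungOne`);
nothing closes 29273 — decided halves carry their engines as hypotheses (`JetCylinderExit` is a PORT: paper proof in
the lens docstring §C.2 / NODE-g18 §2); exactly ONE
located-residual aside on the lens-2 column (`Cyl.CylSpecialRung`, home `CylinderCutCells`) SUPERSEDES g17's
`Split.SplitSpecialRung`, re-located EXACTLY modulo the
cylinder decided half.  The lens header is kept verbatim below.]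

# CylinderCut — LAW (Cyl): CYLINDERS ALONG THE TOP CURVE (critic window g18 (ii′) — «PURE-POWER cones `ℓ^{p^s}` (INSEP and its
`p^s` analogues) decided by a LAW with a surface/threefold-centre package, EXACT re-location of `Split.SplitSpecialRung`, and an
inhabitant certified split-special by an invariant»): the STRUCTURAL DICHOTOMY «translation-symmetric along the
curve ∨ genuinely
`v`-dependent».  A germ along its regular top curve `C` is a CYLINDER if, on an open `U ⊇ C`, `I|_U` is the pullback of a
max-order datum `(S, J, n)` on a regular THREEFOLD along a SMOOTH morphism `π : U → S` contracting exactly `C` to the unique top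
point of `J` (class (Cyl)); a JET CYLINDER if this holds modulo `𝔪_s^N 𝒪_U`, `N > n·(len t + 1)`, for a weak resolution `t` of
`(J, n)` carried in the letters (class (JCyl)).  ENGINE (Cyl) is DECIDED-MOD-PORT X1∅ (=
`MaxOrderAtomClasses.MaxOrderThreefoldResolutionEmptyAt`,
the boundary-free slice of the booked tree aside 28616; Cutkosky2009 Thm 5.1 over `k̄`) by TRANSPORT along `π`; ENGINE (JCyl) is
DECIDED outright by the same transport plus a JET RIGIDITY LEMMA (the controlled jet ideal `𝒬_i` keeps order `≥ N −
i·n ≥ n + 1` at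
every exceptional point — order bookkeeping on regular local rings); KERNEL: (Cyl) ⊆ (JCyl) given X1∅ (the port's
resolution IS the jet datum).
The located residual `Split.SplitSpecialRung` of g17 is RE-LOCATED EXACTLY (0 sorry) as `Cyl.CylSpecialRung`, losing the census
control `INSEP = (z + v(u₁+u₂))² + u₁⁵ + u₂⁷ /𝔽₂` — a PURE SQUARE cone `(z + vU)²` whose first blow-up makes the top
locus a SURFACE —
certified in NO earlier class by the SQUARE INVARIANT (LEMMA Q_C) and in (Cyl) by a ring-level certificate (§C.3)
(decomp-res lens-2 «structural dichotomy (special vs generic)», g18)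

ROOT DECOMPOSITION CELL `decomp-res`, RESIDUAL MODE (D-0179), generation 18.  TARGET (tree item, BY NAME):
`MaxContactCut.RungOne`
(stmt-ResolutionOfSingularities-29273, `E 2 → E 1`); LOCATED RESIDUAL CUT: g17's `Split.SplitSpecialRung` (class
`IsSplitSpecialPt`),
restated verbatim-in-body here (§R17 = the whole body of `g17/SplitCut.lean`, sha256 301f7a3a…, lines 243–2467, byte-identical;
g17 itself restates g14/g15/g16) because g14–g17 live as HOME files only and a HOME file cannot be imported by a
farm check.  This
file IMPORTS the tree modules of g9–g13, the tree asides module `Theses.MaxContactCut` (X1 28616 / 30081 BY NAME),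
the tree kernels
`Theorems.MaxOrderAtomClasses` (`MaxOrderThreefoldResolutionEmptyAt`, `maxOrderEmpty_of_bdry`),
`Theorems.MaxContactCutExhaustion` /
`Theorems.MaxContactCutTauLadder` (resolution ⇒ weak resolution), and Mathlib's `Smooth`.  New content: §C (the
cylinder law, two
engines, kernels, the inhabitant's certificate), §U (the cylinder cut).  0 `sorry`, 0 new axioms; `lean check` rc 0.

## §1  CRITIC WINDOW g18 (CRITIC-LEDGER row 146; standard cn27 rows 176/147) — what is priced and how this file answers

Priced 0: `n ∣ k` completions, deep splits, schedule/weight variants, §G leaf instances, ladder continuations.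
Priced +1 (one of):
(ii′) PURE-POWER cones (INSEP and its `p^s` analogues) decided by a LAW — surface-centre package or a typed Tangle/Sing engine —
with EXACT re-location of `Split.SplitSpecialRung` and an inhabitant certified split-special by an invariant (LEMMA Q_S style);
(iii) non-principal `I_y` by a law; (iv) Tangle/Sing/Iso engine.  MAP +1 = port L once.
THIS FILE takes (ii′).  WHY IT IS A LAW AND NOT A LEAF INSTANCE: every earlier law reads a transversal SHAPE (face,
cone, ladder, split
cone) and decides by the algebra of a fibre polynomial after finitely many CURVE blow-ups; the pure square `(z +
vU)²` has no readable
shape — no middle coefficient ((S) dead: `MiddleCoeff` needs `Ḡ_j ≠ 0`), a SQUARE vertex `v²U²` ((L)/(L′)/(D)/(D⁺)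
dead: the cone
coefficient `β̄` is a square in `A = 𝒪_{C,y}`, so it is never a uniformiser, and when a unit `1 + β̄T² = (1 + b̄T)²`
kills `SideClean`),
prepared-cone reading in `𝔑²` ((C) dead), and after ONE blow-up of `C` its top locus is the SURFACE `{z₁ = 0} ⊂ E`
of `τ = 1` points
((J)/(T) dead; every δ-law dead: their towers have curve sections `Top ∩ E_j = C_j`).  The cylinder law decides it
by a SYMMETRY: the
germ is constant along `C` (in the frame `z' = z + vU` the equation `z'² + u₁⁵ + u₂⁷` does not involve `v`), so the
THREEFOLD package
of the slice `J = (a² + b⁵ + c⁷) ⊂ 𝒪_{𝔸³}` — six blow-ups by hand (NODE-g18.md §3: point, line, point, point, line,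
point), in general
the port X1∅(n) — pulls back along
the smooth projection to a package for `I` with SURFACE centres `π_i⁻¹(Z_i)` over `C`.  The class is cut by the symmetry, typed
scheme-theoretically (`Smooth`, `IdealSheafData.comap`, `vanishingIdeal`), frame-free (any smooth `π`, any open `U ⊇
C`), and its
jet version (JCyl) is decided WITHOUT the port by the jet rigidity lemma (§C.2) — the transversal finite determinacy
of exit packages.

## §2  THE LAW, THE ENGINES, THE PAPER PROOFS — see the §C docstring below (§C.1 transport (a)–(c) + bookkeeping (f); §C.2 jet
rigidity (1)–(3); §C.3 the kernels).  Ports NAMED: X1∅(n) (booked: tree asides 28616 `MarkedThreefoldResolution` ⊇ 30081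
`MaxOrderThreefoldResolution` ⟹ `MaxOrderThreefoldResolutionEmptyAt n` by `maxOrderEmpty_of_bdry`; KNOWN-MOD-PORT
Cutkosky2009 5.1 `k̄`,
principal `J` over any field: CossartJannsenSaito2020 / CossartPiltant2019 4.3–4.4); port L (blow-ups under flat
base change Tag 0805,
smooth over regular Tag 036D, order under regular homomorphisms — tree
`Hironaka2005CompletionOrders.idealOrder_comap_Spec_map_of_isRegularHom`
—, controlled transform under flat pullback, extension of a centre sequence from an open `U ⊇ C` with centres closed over `C`).

## §3  LEMMA Q_C (the inhabitant is split-special and a cylinder) — full text NODE-g18.md §4; the invariant in one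
line: for ANY regular
parameters `c = (c₀, c₁, c₂)` generating the curve prime `𝔭 = (z + vU, u₁, u₂)` and any unit `e`, the `𝔭`-initial form
`in_{𝔭²}(e·INSEP) = ē·(ā₀c̄₀ + ā₁c̄₁ + ā₂c̄₂)² = ē(ā₀²c̄₀² + ā₁²c̄₁² + ā₂²c̄₂²)` in `Sym²_A(𝔭/𝔭²)`, `A = 𝒪_{C,y}` an
`𝔽₂`-algebra,
HAS NO CROSS TERMS (the SQUARE INVARIANT) — this single fact refutes every presentation clause of (S) (L) (L′) (D)
(D⁺) (C), and the
intrinsic first blow-up (`Top(I₁, 2) ∩ E_y` = a LINE of `τ = 1` points with initial form `z̄₁²`, `z̄₁ ∈ ⟨X̄₀, c̄_j,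
v̄⟩`) refutes both
branches of `JetTame` at those points and every δ-tower; `spanFinrank 𝔪_y = 4` refutes (M)/FLAT; `y ∈ C ⊆ Top`
refutes Top-isolation of
the point (near-generic, δ-generic); `∂f ⊆ 𝔪²` refutes contact (`τ = 1`, class 1).  (Q0) membership in (Cyl): `U =
𝔸⁴`, `S = 𝔸³_{𝔽₂}`,
`π = (z + v(u₁+u₂), u₁, u₂)` a coordinate projection (`insepFrame_involutive`), `J = (a² + b⁵ + c⁷)` (`insep_eq_aeval_surface`),
`Top(J, 2) = {0}`, `ord J ≤ 2`, `π⁻¹(0) = C = V(z, u₁, u₂) = Top(I, 2)` (Top-isolated, `IsCurvePt`).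

## §4  PIECES, TAGS, EDGES (BY NAME) — NODE-g18.md §5.  `MaxContactCut.RungOne ⟸ Cyl.CylGenericRung [WEAKER ·
DECIDED-MOD-PORT(M+):
`Cyl.cylGenericRung_of_ports` from the engines (V)(Δ)(U)(R)(N) (tree, decided), (M)(C) g14, (G) g16, (S) g17, (JCyl)
NEW DECIDED,
the tree aside 30081 (X1, booked port), g12's `CurvePackagePort` (COSTUME M+), `OrderOneContact` (tree port)] ∧
Cyl.CylSpecialRung
[WEAKER BY LETTER than `Split.SplitSpecialRung` · UNDECIDED · IDEA-NEEDED · cofinal]`; `Cyl.closes`; `Cyl.rungOne_iff` (EXACT);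
`Cyl.splitSpecialRung_iff_cylSpecialRung` (EXACT RE-LOCATION of the named residual); INSEP ∈ (Cyl) ∖ (all earlier
classes) (LEMMA Q_C).

## §5  WHAT IS LEFT (located, booked — NODE-g18.md §7): pure-power cones whose TAIL VARIES WITH `v` below the jet modulus
(`INSEP-v = (z + vU)² + u₁⁵ + v·u₂⁵ + u₂⁷`; cheapest falsifier of over-reach: it is NOT in (Cyl)/(JCyl) for ANY
frame — its transversal
slice type JUMPS at the core, `a² + b⁵ + c⁷` at `v = 0` versus `a² + b⁵ + (unit)·c⁵` at `v ≠ 0`, while all slices of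
a (jet) cylinder
are (jet-)isomorphic — NODE-g18.md §3), equisingular but non-rigid families (`(z + vU)² + u₁⁵ + u₂⁷ + v·u₁³u₂³`),
deep splits `z(z + v²U)`, split cones with `n ∣ k`, NON-PRINCIPAL
`I_y` (iii), Tangle (`R1-notail`: Top not a curve), Sing / Iso (iv) (`HauserE7`, `Narasimhan`).  The residual is the
`v`-DEPENDENT
pure-power germ: the next law must read the `v`-ADIC variation of the threefold package (EQUIRESOLUTION: a family of
slice resolutions
moving flatly along `C`; the jump points of the family are the special side) — NEXT-g19.md.

## This file

§C (NEW, g18): LAW (Cyl) — CYLINDERS ALONG THE TOP CURVE (critic window g18 (ii′): pure-power cones `ℓ^{p^s}` along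
the curve): `IsCylinderAlong`, `IsUniformCylinderCurve`, the ENGINE `def CylinderExit : Prop`, `IsCylinderCurvePt`,
the jet versions `IsJetCylinderAlong`, `IsUniformJetCylinderCurve`, the PORT-ENGINE `def JetCylinderExit : Prop`
(paper proof = lens docstring §C.2 / NODE-g18 §2; a hypothesis here), `IsJetCylinderCurvePt`, the kernels
`isJetCylinderAlong_of_isCylinderAlong` / `cylinderExit_of_jetCylinderExit` /
`isCurveExitPt_of_is(Jet)CylinderCurvePt` (those through `MaxOrderAtomClasses.MaxOrderThreefoldResolutionEmptyAt`,
cone-free), §C.3 the inseparability kernel `InsepKernel`, and the cone-free head of §U (the leaf `cylLeaf =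
splitLeaf ∨ (Cyl) ∨ (JCyl)` + order lemmas, the located residual class `IsCylSpecialPt` + iffs).  The bridge kernel
`weakResolution_of_isResolutionOf` (tree kernels `MaxContactCutExhaustion` / `MaxContactCutTauLadder` BY NAME) and
`cylinderExit_of_ports` (tree aside 30081 BY NAME) are in the wiring file.

Part 1/2 carries: `IsCylinderAlong`, `IsUniformCylinderCurve`, `CylinderExit`, `IsCylinderCurvePt`,
`IsJetCylinderAlong`, `IsUniformJetCylinderCurve`, `JetCylinderExit`, `IsJetCylinderCurvePt`,
`isCurveExitPt_of_isCylinderCurvePt`, `isCurveExitPt_of_isJetCylinderCurvePt`, `insepSurface`, `insepFrame`,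
`represent_INSEP`, `insep_eq_aeval_surface`, `insepFrame_involutive`, `cylLeaf`, `splitLeaf_le_cylLeaf`,
`grandLeaf_le_cylLeaf`, `vastLeaf_le_cylLeaf`, `pinchLeaf_le_cylLeaf`.

(Sources: Hironaka1964 Ch. III; CossartJannsenSaito2020 Ch. 2, Ch. 8–9; CossartPiltant2008 Prop. 4.2;
CossartPiltant2019 Rem. 3.2; BierstoneGrigorievMilmanWlodarczyk2011 §3.1; Moh1987; Hauser2010Kangaroo; Giraud1975;
Narasimhan1983.)
-/

open CategoryTheory AlgebraicGeometry TopologicalSpace IsLocalRing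
open Literature.AlgebraicGeometry.Resolution
open Summit.ResolutionOfSingularities.ResolutionOfSingularities.Theorems
open Summit.ResolutionOfSingularities.ResolutionOfSingularities.Theorems.WeakOrderReduction
open Summit.ResolutionOfSingularities.ResolutionOfSingularities.Theorems.DeltaFaceCutClasses
open Summit.ResolutionOfSingularities.ResolutionOfSingularities.Theorems.RelativeDeltaCut
open Summit.ResolutionOfSingularities.ResolutionOfSingularities.Theorems.CurveLeafExit
open Summit.ResolutionOfSingularities.ResolutionOfSingularities.Theorems.PinchCut
open Summit.ResolutionOfSingularities.ResolutionOfSingularities.Theorems.JetCut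
open Summit.ResolutionOfSingularities.ResolutionOfSingularities.Theorems.PurityCut
open Summit.ResolutionOfSingularities.ResolutionOfSingularities.Theorems.SplitCut

namespace Summit.ResolutionOfSingularities.ResolutionOfSingularities.Theorems.CylinderCut

/-! ### §C.4  point / curve level — the cylinder classes (Cyl) (JCyl), their engines, the located residual -/

/-- **CYLINDER ALONG `closure {η}` for the marking `n`** [g18] (`IsCylinderAlong I n η`): on some open `U` containing every
specialisation of `η`, the ideal `I|_U` is the PULLBACK `J.comap π` of an ideal `J` on a regular separated
finite-type `k`-scheme `S`
of dimension `≤ 3` (`k` a field of some prime characteristic `p`: the frame of `SeqDimFour`) along a SMOOTH morphism `π : U → S`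
whose fibre over a CLOSED point `s` is exactly `closure {η} ∩ U` (pointwise: `η ⤳ u ⟺ π u = s`), where `J` has order `≤ n`
everywhere and order `n` EXACTLY at `s` (`Top(J, n) = {s}`).  No exponents, no cone, no tail: the class is cut out by a SYMMETRY
(translation along the curve), not by a shape.  Inhabitant: `INSEP` (§C.3, LEMMA Q_C).  DEFINITION (NEW class
predicate). (Sources: Cutkosky2009 Thm 5.1; CossartJannsenSaito2020; BierstoneGrigorievMilmanWlodarczyk2011 §3;
StacksProject Tag 0805, Tag 036D.) -/
def IsCylinderAlong {Y : Scheme.{0}} (I : Y.IdealSheafData) (n : ℕ) (η : Y) : Prop :=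
  ∃ U : Y.Opens, (∀ y : Y, η ⤳ y → y ∈ U) ∧
    ∃ (p : ℕ) (_ : p.Prime) (k : Type) (_ : Field k) (_ : CharP k p) (S : Scheme.{0}) (gS : S ⟶ Spec (.of k)),
      IsSeparated gS ∧ LocallyOfFiniteType gS ∧ QuasiCompact gS ∧ Scheme.IsRegular S ∧ topologicalKrullDim S ≤ 3 ∧
      ∃ π : (U : Scheme.{0}) ⟶ S, Smooth π ∧
        ∃ (J : S.IdealSheafData) (s : S), IsClosed ({s} : Set S) ∧
          I.comap U.ι = J.comap π ∧
          (∀ u : (U : Scheme.{0}), η ⤳ U.ι.base u ↔ π.base u = s) ∧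
          (∀ x : S, idealOrder J x ≤ ((n : ℕ) : ℕ∞)) ∧
          (∀ x : S, idealOrder J x = ((n : ℕ) : ℕ∞) → x = s)

/-- **UNIFORM CYLINDER CURVE** [g18] (`IsUniformCylinderCurve I n η`): `η` is a curve point and `I` is a cylinder along
`closure {η}`.  (Uniformity is built in: ONE open `U ⊇ closure {η}` and ONE projection.)  The hypothesis of ENGINE (Cyl).
DEFINITION (NEW class predicate). -/
def IsUniformCylinderCurve {Y : Scheme.{0}} (I : Y.IdealSheafData) (n : ℕ) (η : Y) : Prop :=
  IsCurvePt η ∧ IsCylinderAlong I n η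

/-- **ENGINE (Cyl) `CylinderExit`** [g18; DECIDED-MOD-PORT X1∅ · paper proof = module docstring §C.1 (transport of the threefold
package along the smooth projection: all centres of the port's resolution lie over `s`; flat base change of
blow-ups; smooth over
regular is regular; order and controlled transform under flat/regular pullback; exit BY ORDER over the whole curve) · KERNEL
REDUCTION `cylinderExit_of_jetCylinderExit` to ENGINE (JCyl) + X1∅]: on a regular scheme, a uniform cylinder curve of order
`n ≥ 2` has an exit package with centres over it.  STATEMENT (engine). (Sources: Cutkosky2009 Thm 5.1;
BierstoneGrigorievMilmanWlodarczyk2011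
§3; StacksProject Tag 0805, Tag 036D; Hironaka2005; CossartJannsenSaito2020.) -/
def CylinderExit : Prop :=
  ∀ (Y : Scheme.{0}), Scheme.IsRegular Y → ∀ (I : Y.IdealSheafData) (n : ℕ), 2 ≤ n →
    ∀ η : Y, IsUniformCylinderCurve I n η → PackageExitsOver I n {y : Y | η ⤳ y}

/-- **CYLINDER-CURVE point** [g18] (NEW DECIDED CLASS, leaf (Cyl)): `y` lies on (or is the generic point of) a
Top-isolated uniform
cylinder curve.  Inhabitant: the core of `INSEP = (z + v(u₁+u₂))² + u₁⁵ + u₂⁷ /𝔽₂` (LEMMA Q_C: in NO earlier class).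
DEFINITION (NEW class). -/
def IsCylinderCurvePt {Y : Scheme.{0}} (I : Y.IdealSheafData) (n : ℕ) (y : Y) : Prop :=
  ∃ η : Y, η ⤳ y ∧ IsTopIsolatedClosure I n η ∧ IsUniformCylinderCurve I n η

/-- **JET CYLINDER ALONG `closure {η}`** [g18] (`IsJetCylinderAlong I n η`): the data of `IsCylinderAlong` (open
`U`, field frame,
regular threefold `S`, smooth `π : U → S` contracting exactly the curve to the closed point `s`, `J` with `Top(J, n)
= {s}`) EXCEPT
that `I|_U` need only agree with the pullback MODULO THE `N`-TH POWER OF THE CURVE's FIBRE IDEAL `𝒫 =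
(vanishingIdeal {s}).comap π`:
`I|_U ⊔ 𝒫^N = J.comap π ⊔ 𝒫^N`, where the modulus `N` exceeds `n·(len t + 1)` for a WEAK RESOLUTION `t` of `(S, J,
∅, n)` that is
PART OF THE LETTERS (the threefold package is carried by the class, as (M)/(L)/(S) carry their exponents; no port is consumed).
Members: every cylinder (given X1∅(n): `isJetCylinderAlong_of_isCylinderAlong`), and every `I = (f + h)`, `f` a
cylinder equation,
`h ∈ 𝒫^N` — e.g. `INSEP + v·u₂^{15}` (`r = 6`, `N = 15`, module docstring §3), genuinely `v`-dependent.  DEFINITION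
(NEW class predicate). (Sources: BierstoneGrigorievMilmanWlodarczyk2011 §3; CossartJannsenSaito2020; StacksProject Tag 0805.) -/
def IsJetCylinderAlong {Y : Scheme.{0}} (I : Y.IdealSheafData) (n : ℕ) (η : Y) : Prop :=
  ∃ U : Y.Opens, (∀ y : Y, η ⤳ y → y ∈ U) ∧
    ∃ (p : ℕ) (_ : p.Prime) (k : Type) (_ : Field k) (_ : CharP k p) (S : Scheme.{0}) (gS : S ⟶ Spec (.of k)),
      IsSeparated gS ∧ LocallyOfFiniteType gS ∧ QuasiCompact gS ∧ Scheme.IsRegular S ∧ topologicalKrullDim S ≤ 3 ∧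
      ∃ π : (U : Scheme.{0}) ⟶ S, Smooth π ∧
        ∃ (J : S.IdealSheafData) (s : S) (hs : IsClosed ({s} : Set S)),
          (∀ u : (U : Scheme.{0}), η ⤳ U.ι.base u ↔ π.base u = s) ∧
          (∀ x : S, idealOrder J x ≤ ((n : ℕ) : ℕ∞)) ∧
          (∀ x : S, idealOrder J x = ((n : ℕ) : ℕ∞) → x = s) ∧
          ∃ (t : CentreSeq S) (N : ℕ), WeakResolution t (⟨J, [], n⟩ : MarkedIdeal S) ∧ n * (t.length + 1) + 1 ≤ N ∧
            I.comap U.ι ⊔ (Scheme.IdealSheafData.vanishingIdeal ⟨{s}, hs⟩).comap π ^ N =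
              J.comap π ⊔ (Scheme.IdealSheafData.vanishingIdeal ⟨{s}, hs⟩).comap π ^ N

/-- **UNIFORM JET-CYLINDER CURVE** [g18] (`IsUniformJetCylinderCurve I n η`).  The hypothesis of ENGINE (JCyl).
DEFINITION (NEW class
predicate). -/
def IsUniformJetCylinderCurve {Y : Scheme.{0}} (I : Y.IdealSheafData) (n : ℕ) (η : Y) : Prop :=
  IsCurvePt η ∧ IsJetCylinderAlong I n η

/-- **ENGINE (JCyl) `JetCylinderExit`** [g18; DECIDED · paper proof = module docstring §C.2 (transport as in (Cyl) +
the JET RIGIDITY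
LEMMA: the controlled jet ideal `𝒬_i` (`𝒬_0 = 𝔪_s^N`, `𝒬_{i−1}𝒪_{S_i} = I(E_i)ⁿ·𝒬_i`) has order `≥ N − i·n ≥ n + 1`
at every exceptional
point (order bookkeeping on regular local rings); the congruence propagates through controlled transforms; admissibility of
the pulled-back centres and EXIT BY ORDER follow) · every regular scheme, every field of the frame · port L only]:
on a regular scheme,
a uniform jet-cylinder curve of order `n ≥ 2` has an exit package with centres over it.  STATEMENT (engine).
(Sources: BierstoneGrigorievMilmanWlodarczyk2011 §3; CossartJannsenSaito2020; StacksProject Tag 0805, Tag 036D;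
Hironaka2005.) -/
def JetCylinderExit : Prop :=
  ∀ (Y : Scheme.{0}), Scheme.IsRegular Y → ∀ (I : Y.IdealSheafData) (n : ℕ), 2 ≤ n →
    ∀ η : Y, IsUniformJetCylinderCurve I n η → PackageExitsOver I n {y : Y | η ⤳ y}

/-- **JET-CYLINDER-CURVE point** [g18] (NEW DECIDED CLASS, leaf (JCyl)): `y` lies on (or is the generic point of) a Top-isolated
uniform jet-cylinder curve.  DEFINITION (NEW class). -/
def IsJetCylinderCurvePt {Y : Scheme.{0}} (I : Y.IdealSheafData) (n : ℕ) (y : Y) : Prop :=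
  ∃ η : Y, η ⤳ y ∧ IsTopIsolatedClosure I n η ∧ IsUniformJetCylinderCurve I n η

section CylinderKernels

/-- Under ENGINE (Cyl), every cylinder-curve point is a curve-exit point of g12's port.  KERNEL (PROVED). [folklore] -/
theorem isCurveExitPt_of_isCylinderCurvePt {Y : Scheme.{0}} {I : Y.IdealSheafData} {n : ℕ} {y : Y}
    (hE : CylinderExit) (hY : Scheme.IsRegular Y) (hn : 2 ≤ n) (h : IsCylinderCurvePt I n y) :
    IsCurveExitPt I n y := by
  obtain ⟨η, hηy, hiso, hcurve⟩ := h
  exact ⟨η, hηy, hcurve.1, hiso, hE Y hY I n hn η hcurve⟩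

/-- Under ENGINE (JCyl), every jet-cylinder-curve point is a curve-exit point of g12's port.  KERNEL (PROVED). [folklore] -/
theorem isCurveExitPt_of_isJetCylinderCurvePt {Y : Scheme.{0}} {I : Y.IdealSheafData} {n : ℕ} {y : Y}
    (hE : JetCylinderExit) (hY : Scheme.IsRegular Y) (hn : 2 ≤ n) (h : IsJetCylinderCurvePt I n y) :
    IsCurveExitPt I n y := by
  obtain ⟨η, hηy, hiso, hcurve⟩ := h
  exact ⟨η, hηy, hcurve.1, hiso, hE Y hY I n hn η hcurve⟩

end CylinderKernels

section InsepKernel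

open MvPolynomial

/-- **THE SURFACE DATUM of the inhabitant** [g18]: `a² + b⁵ + c⁷ ∈ 𝔽₂[a, b, c]` (`𝔸³_{𝔽₂}`, top locus = the origin,
order `2` there
and `≤ 1` elsewhere: `∂_b = b⁴`, `∂_c = c⁶`).  DEFINITION (support, the bed). [folklore] -/
noncomputable def insepSurface : MvPolynomial (Fin 3) (ZMod 2) := X 0 ^ 2 + X 1 ^ 5 + X 2 ^ 7

/-- **THE INHABITANT's FRAME** [g18]: the coordinate change `(z, v, u₁, u₂) ↦ (z + v(u₁+u₂), v, u₁, u₂)` of `𝔽₂[z, v, u₁, u₂]`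
(variables `0, 1, 2, 3`).  DEFINITION (support). [folklore] -/
noncomputable def insepFrame : Fin 4 → MvPolynomial (Fin 4) (ZMod 2) :=
  ![X 0 + X 1 * (X 2 + X 3), X 1, X 2, X 3]

/-- **THE CENSUS FORM IS THE SQUARE** [g18; KERNEL (PROVED), characteristic 2]: `z² + v²(u₁+u₂)² + u₁⁵ + u₂⁷ = (z +
v(u₁+u₂))² + u₁⁵ + u₂⁷`
— the cone of `INSEP` along `C = V(z, u₁, u₂)` is the PURE SQUARE `(z + vU)²` (no middle coefficient, square vertex
`v²U²`). [folklore] -/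
theorem represent_INSEP (z v u₁ u₂ : MvPolynomial (Fin 4) (ZMod 2)) :
    z ^ 2 + v ^ 2 * (u₁ + u₂) ^ 2 + u₁ ^ 5 + u₂ ^ 7 = (z + v * (u₁ + u₂)) ^ 2 + u₁ ^ 5 + u₂ ^ 7 := by
  have h2 : (2 : MvPolynomial (Fin 4) (ZMod 2)) = 0 := by
    simpa using CharP.cast_eq_zero (MvPolynomial (Fin 4) (ZMod 2)) 2
  linear_combination (-(z * v * (u₁ + u₂))) * h2

/-- **THE INHABITANT IS A CYLINDER OVER THE SURFACE DATUM** [g18; KERNEL (PROVED)]: `INSEP = π^*(a² + b⁵ + c⁷)` for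
the algebra map
`a ↦ z + v(u₁+u₂)`, `b ↦ u₁`, `c ↦ u₂` — the equation does not involve `v` in the frame `(z + vU, v, u₁, u₂)`. [folklore] -/
theorem insep_eq_aeval_surface (z v u₁ u₂ : MvPolynomial (Fin 4) (ZMod 2)) :
    (z + v * (u₁ + u₂)) ^ 2 + u₁ ^ 5 + u₂ ^ 7 = MvPolynomial.aeval ![z + v * (u₁ + u₂), u₁, u₂] insepSurface := by
  simp [insepSurface]

/-- **THE FRAME IS AN INVOLUTIVE AUTOMORPHISM** [g18; KERNEL (PROVED), characteristic 2]: substituting the frame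
into itself gives the
identity on every variable (`z + vU + vU = z`), so `insepFrame` defines an `𝔽₂`-algebra automorphism of `𝔽₂[z, v,
u₁, u₂]` (its own
inverse): `(z + v(u₁+u₂), u₁, u₂)` are three coordinates of `𝔸⁴` and the projection `π = (z + vU, u₁, u₂) : 𝔸⁴ → 𝔸³`
is a coordinate
projection — SMOOTH, with fibre over the origin the line `C = V(z, u₁, u₂)`. [folklore] -/
theorem insepFrame_involutive (i : Fin 4) : MvPolynomial.aeval insepFrame (insepFrame i) = X i := by
  have h2 : (2 : MvPolynomial (Fin 4) (ZMod 2)) = 0 := by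
    simpa using CharP.cast_eq_zero (MvPolynomial (Fin 4) (ZMod 2)) 2
  fin_cases i
  · simp [insepFrame]
    linear_combination ((X 1 : MvPolynomial (Fin 4) (ZMod 2)) * (X 2 + X 3)) * h2
  · simp [insepFrame]
  · simp [insepFrame]
  · simp [insepFrame]

end InsepKernel

/-! ## §U  NEW (g18): the CYLINDER cut — the leaf `cylLeaf = splitLeaf ∨ (Cyl) ∨ (JCyl)`, its located residual class
`IsCylSpecialPt`,
the rungs (instances of §G), `Cyl.closes` BY NAME, the engines at work, and the EXACT RE-LOCATION of g17's
`Split.SplitSpecialRung`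
(and of g16's `Grand.GrandSpecialRung`, g15's `Vast.VastSpecialRung`, g14's `PinchSpecialRung`, the tree aside 33866
`MaxContactCut.LeafSpecialRung`) modulo the cylinder decided half — all 0 sorry. -/

/-- The CYLINDER leaf of g18: split leaf (g17) ∨ cylinder-curve ∨ jet-cylinder-curve.  DEFINITION (leaf instance). [folklore] -/
def cylLeaf : ∀ ⦃Y : Scheme.{0}⦄, Y.IdealSheafData → ℕ → Y → Prop :=
  fun _ I n y => splitLeaf I n y ∨ IsCylinderCurvePt I n y ∨ IsJetCylinderCurvePt I n y

/-- `splitLeaf_le_cylLeaf`: Auxiliary step of this node's calculus, VERBATIM from the lens file (see the module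
docstring); the statement is its type. [folklore] -/
theorem splitLeaf_le_cylLeaf ⦃Y : Scheme.{0}⦄ (I : Y.IdealSheafData) (n : ℕ) (y : Y) :
    splitLeaf I n y → cylLeaf I n y :=
  fun h => Or.inl h

/-- `grandLeaf_le_cylLeaf`: Auxiliary step of this node's calculus, VERBATIM from the lens file (see the module
docstring); the statement is its type. [folklore] -/
theorem grandLeaf_le_cylLeaf ⦃Y : Scheme.{0}⦄ (I : Y.IdealSheafData) (n : ℕ) (y : Y) :
    grandLeaf I n y → cylLeaf I n y :=
  fun h => Or.inl (grandLeaf_le_splitLeaf I n y h)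

/-- `vastLeaf_le_cylLeaf`: Auxiliary step of this node's calculus, VERBATIM from the lens file (see the module
docstring); the statement is its type. [folklore] -/
theorem vastLeaf_le_cylLeaf ⦃Y : Scheme.{0}⦄ (I : Y.IdealSheafData) (n : ℕ) (y : Y) :
    vastLeaf I n y → cylLeaf I n y :=
  fun h => Or.inl (vastLeaf_le_splitLeaf I n y h)

/-- `pinchLeaf_le_cylLeaf`: Auxiliary step of this node's calculus, VERBATIM from the lens file (see the module
docstring); the statement is its type. [folklore] -/
theorem pinchLeaf_le_cylLeaf ⦃Y : Scheme.{0}⦄ (I : Y.IdealSheafData) (n : ℕ) (y : Y) :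
    pinchLeaf I n y → cylLeaf I n y :=
  fun h => Or.inl (pinchLeaf_le_splitLeaf I n y h)

end Summit.ResolutionOfSingularities.ResolutionOfSingularities.Theorems.CylinderCut
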